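import Literature.AlgebraicGeometry.ModuliOfAbelianVarieties.SiegelModuliSliceGlueData
import HarnessLib

/-!
# A fine moduli scheme from REPRESENTED OPEN CHARTS of the moduli functor — the generic (8δ)+(8ε) junction
# ([MumfordFogartyKirwan1994] Prop. 7.6: «the functor `ℳ_R` is represented by `V_R` … `ℳ` is represented by the union `A`»)

Layer `Literature/AlgebraicGeometry/ModuliOfAbelianVarieties`, namespace `Literature.AlgebraicGeometry.ModuliOfAbelianVarieties`.
THEOREMS ONLY (no definition, no named fact, no instance, no notation, no `sorry`).  Cell `hodgecm-mathlib` (D-0151), F-DAG row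
F-8 (8ε) — FILE 2A of the ASSEMBLY (B-p08 (g13); census `B-provers/B-p08/g13/CENSUS-8e-Assembly.B-p08g13.md`; sequencer B-plan1
(g16) 08:50:54Z «FILE 2 THEOREM-ONLY `∃ 𝓜 : SiegelFineModuliScheme g N δ, …`»).  HC_CM is proved only modulo the 7 printed citations
until rung 0 closes; nothing here is about HC.

[MumfordFogartyKirwan1994] Ch. 7 §2 Prop. 7.6 (p. 136; proof pp. 136–138): from OPEN SUB-FUNCTORS `𝓕_R` of Mumford's moduli functor
(abstractly: open conditions `Fr`/`frOpen` with the one-clause base-change/iso-invariance property `hFr`) each REPRESENTED by a chart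
(`V R`, `ZV R`) (`hrep` — «`ℳ_R` is represented by `V_R`», the slice theorem (8γ)) with `ZV R` itself `R`-framed (`huniv`), ★ (8δ)
`exists_glued_of_representedCharts` (B-p04 (g20)) GLUES the charts along the unique transition morphisms into a locally Noetherian
ℚ-scheme `M = ⋃ V_R` carrying a glued triple `Z` (given the F-3 data: dual pairs in the letter of record `hdual`, projective slices
`hprojV`, the slice unit hypotheses `unitV`), and ★ (8ε) FILE 1 `SiegelFineModuliScheme.classify_of_openCharts_of_specHom` (B-p08
(g13)) proves the fine-moduli property of `(M, Z)` whenever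
every geometric triple satisfies some condition (`hcov`, [MumfordFogartyKirwan1994] Prop. 7.7's count).  THIS FILE is the two-line
junction, stated as the EXISTENCE OF A FINE MODULI SCHEME in the tree's carrier ★ `SiegelFineModuliScheme` together with its CHART
STRUCTURE (open immersions `j R : V R ↪ 𝓜.M` over ℚ, jointly surjective, along which `𝓜.univ` restricts to `ZV R`) — the data F-9
(quasi-projectivity) and F-11 (smoothness) read chartwise.  FILE 2B instantiates `Fr := IsFrameOn`, `V R :=` the standard-frame slices
of the linearly rigidified covariant ((8α)/(8β)/(8γ)).  EDITION 2 (B-p08 (g13), DRIFT-1): the open-sub-functor clause `hFr` is asked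
of ℚ-SCHEMES ONLY (the class on which ★ `SiegelModuliFrameSubfunctor` proves it) and the F-3 binder is the pen's letter (L).

## References
* [MumfordFogartyKirwan1994] D. Mumford, J. Fogarty, F. Kirwan, *Geometric Invariant Theory*, 3rd ed. (1994), Ch. 7 §2 Def. 7.2–7.3
  (p. 129), Prop. 7.6 (p. 136; proof pp. 136–138), Prop. 7.7 (p. 138), §3 Thm. 7.9 and the remark after it (p. 139).
* [Deligne1971TravauxShimura] P. Deligne, *Travaux de Shimura*, Sém. Bourbaki 389 (1971), 4.16 (p. 150).
-/

noncomputable section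

-- the `Over`-category structure maps of ★ `baseChange` are not reducible (as in ★ `SiegelModuliOfOpenCharts`).
set_option backward.isDefEq.respectTransparency false

open CategoryTheory CategoryTheory.Limits AlgebraicGeometry TopologicalSpace
open Literature.AlgebraicGeometry.AbelianSchemes Literature.AlgebraicGeometry.Motives
open Literature.AlgebraicGeometry.Morphisms (IsProjective)

namespace Literature.AlgebraicGeometry.ModuliOfAbelianVarieties

open PolarizedAbelianSchemeWithLevel AbelianSchemeOver

variable {g N : ℕ} {δ : Fin g → ℕ}

/-- **[MumfordFogartyKirwan1994] Prop. 7.6 — A FINE MODULI SCHEME FROM REPRESENTED OPEN CHARTS.**  Given open conditions `Fr`/`frOpen`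
on polarized abelian schemes with level-`N` structure (`N ≥ 3`, `δ` a polarization type) with the base-change/iso-invariance clause `hFr`,
charts `V R` (locally Noetherian ℚ-schemes) with triples `ZV R` that are `R`-framed (`huniv`) and REPRESENT the `R`-th condition (`hrep`:
every `R`-framed triple over a locally Noetherian ℚ-scheme is the pull-back of `ZV R` along a unique morphism to `V R`), dual pairs for all
abelian schemes that are Zariski-locally pull-backs of PROJECTIVE ones (`hdual`, the F-3 letter «[MumfordFogartyKirwan1994] Cor. 6.8
Zariski-locally on the base»; the slices are projective, `hprojV`) and the unit hypotheses of the charts' Poincaré sheaves (`unitV`) — the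
F-3 data —, and the covering hypothesis
`hcov` (every triple over an algebraically closed field satisfies some condition — [MumfordFogartyKirwan1994] Prop. 7.7): THERE IS a fine
moduli scheme `𝓜 : SiegelFineModuliScheme g N δ` (★ carrier: `M`, `univ`, `classify`) COVERED by open immersions `j R : V R ↪ 𝓜.M` over ℚ
along which `𝓜.univ` restricts to `ZV R` — ★ (8δ) `exists_glued_of_representedCharts` ⊕ ★ (8ε) `SiegelFineModuliScheme.classify_of_openCharts`.
[cite: MumfordFogartyKirwan1994, Ch. 7 §2 Proposition 7.6 (p. 136; proof pp. 136–138)]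
[cite: MumfordFogartyKirwan1994, Ch. 7 §2 Definitions 7.2–7.3 (p. 129); §3 Theorem 7.9 and the remark after it (p. 139)]
[cite: Deligne1971TravauxShimura, 4.16 p. 150] -/
theorem exists_siegelFineModuliScheme_of_representedCharts (hN : 3 ≤ N) (hδ : IsPolarizationType δ)
    {ι : Type} (Fr : ∀ ⦃T : Scheme.{0}⦄, PolarizedAbelianSchemeWithLevel g N δ T → ι → Prop)
    (frOpen : ∀ ⦃T : Scheme.{0}⦄, PolarizedAbelianSchemeWithLevel g N δ T → ι → T.Opens)
    (hFr : ∀ ⦃T T' : Scheme.{0}⦄ [IsLocallyNoetherian T] [IsLocallyNoetherian T'] (_ : T ⟶ Spec (.of ℚ))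
      (_ : T' ⟶ Spec (.of ℚ)) (P' : PolarizedAbelianSchemeWithLevel g N δ T) (P'' : PolarizedAbelianSchemeWithLevel g N δ T')
      (u : T' ⟶ T) (G : P''.A.X.left ⟶ P'.A.X.left) (Ĝ : P''.D.hat.X.left ⟶ P'.D.hat.X.left),
      P''.IsBaseChangeVia P' u G Ĝ → ∀ R, (Fr P'' R ↔ u ⁻¹ᵁ frOpen P' R = ⊤))
    (V : ι → Scheme.{0}) [∀ R, IsLocallyNoetherian (V R)] (fV : ∀ R, V R ⟶ Spec (.of ℚ))
    (ZV : ∀ R, PolarizedAbelianSchemeWithLevel g N δ (V R)) (huniv : ∀ R, Fr (ZV R) R)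
    (hrep : ∀ R ⦃T : Scheme.{0}⦄ [IsLocallyNoetherian T] (_fT : T ⟶ Spec (.of ℚ))
      (P' : PolarizedAbelianSchemeWithLevel g N δ T), Fr P' R →
      ∃! v : T ⟶ V R, ∃ (G : P'.A.X.left ⟶ (ZV R).A.X.left) (Ĝ : P'.D.hat.X.left ⟶ (ZV R).D.hat.X.left),
        P'.IsBaseChangeVia (ZV R) v G Ĝ)
    (hprojV : ∀ R, IsProjective (ZV R).A.X.hom)
    (hdual : ∀ ⦃S : Scheme.{0}⦄ [IsLocallyNoetherian S] (_fS : S ⟶ Spec (.of ℚ)) (A : AbelianSchemeOver S),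
      (∀ s : S, ∃ (U : Scheme.{0}) (i : U ⟶ S) (_ : IsOpenImmersion i) (_ : s ∈ Set.range i.base)
        (B : AbelianSchemeOver U) (G : B.X.left ⟶ A.X.left), B.IsBaseChangeVia A i G ∧ IsProjective B.X.hom) →
      Nonempty A.DualPair)
    (unitV : ∀ R, Nonempty ((Scheme.Modules.pullback (DualPair.unitHatSlice (ZV R).D)).obj (ZV R).D.P ≅
      SheafOfModules.unit _))
    (hcov : ∀ ⦃Ω : Type⦄ [Field Ω] [IsAlgClosed Ω] (_ : Spec (.of Ω) ⟶ Spec (.of ℚ))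
      (Q : PolarizedAbelianSchemeWithLevel g N δ (Spec (.of Ω))), ∃ R, Fr Q R) :
    ∃ (𝓜 : SiegelFineModuliScheme g N δ) (j : ∀ R, V R ⟶ 𝓜.M.left) (_ : ∀ R, IsOpenImmersion (j R))
      (_ : ∀ R, j R ≫ 𝓜.M.hom = fV R)
      (Gc : ∀ R, (ZV R).A.X.left ⟶ 𝓜.univ.A.X.left) (Ĝc : ∀ R, (ZV R).D.hat.X.left ⟶ 𝓜.univ.D.hat.X.left),
      (∀ R, (ZV R).IsBaseChangeVia 𝓜.univ (j R) (Gc R) (Ĝc R)) ∧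
      (∀ R R', (j R') ⁻¹ᵁ (j R).opensRange = frOpen (ZV R') R) ∧ (⨆ R, (j R).opensRange = ⊤) := by
  obtain ⟨M, hM, Z, j, hj, hjq, Gc, Ĝc, hchart, hglue, hjcov⟩ :=
    exists_glued_of_representedCharts_of_specHom Fr frOpen hFr V fV ZV huniv hrep hN hδ hprojV hdual unitV
  exact ⟨⟨M, hM, Z, SiegelFineModuliScheme.classify_of_openCharts_of_specHom hN M Z Fr frOpen hFr hcov V j ZV Gc Ĝc hchart
    hglue hjcov hrep⟩, j, hj, hjq, Gc, Ĝc, hchart, hglue, hjcov⟩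

/-- **Hence Mumford's functor HAS a fine moduli scheme** under the hypotheses of `exists_siegelFineModuliScheme_of_representedCharts`
(the bare existence `Nonempty (SiegelFineModuliScheme g N δ)`, which by ★ `SiegelFineModuliScheme.isoOfClassify` pins ONE ℚ-scheme up to
isomorphism — [Deligne1971TravauxShimura, 4.16] «représenté par un ℚ-schéma»).
[cite: MumfordFogartyKirwan1994, Ch. 7 §2 Proposition 7.6 (p. 136; proof pp. 136–138)] [cite: Deligne1971TravauxShimura, 4.16 p. 150] -/
theorem nonempty_siegelFineModuliScheme_of_representedCharts (hN : 3 ≤ N) (hδ : IsPolarizationType δ)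
    {ι : Type} (Fr : ∀ ⦃T : Scheme.{0}⦄, PolarizedAbelianSchemeWithLevel g N δ T → ι → Prop)
    (frOpen : ∀ ⦃T : Scheme.{0}⦄, PolarizedAbelianSchemeWithLevel g N δ T → ι → T.Opens)
    (hFr : ∀ ⦃T T' : Scheme.{0}⦄ [IsLocallyNoetherian T] [IsLocallyNoetherian T'] (_ : T ⟶ Spec (.of ℚ))
      (_ : T' ⟶ Spec (.of ℚ)) (P' : PolarizedAbelianSchemeWithLevel g N δ T) (P'' : PolarizedAbelianSchemeWithLevel g N δ T')
      (u : T' ⟶ T) (G : P''.A.X.left ⟶ P'.A.X.left) (Ĝ : P''.D.hat.X.left ⟶ P'.D.hat.X.left),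
      P''.IsBaseChangeVia P' u G Ĝ → ∀ R, (Fr P'' R ↔ u ⁻¹ᵁ frOpen P' R = ⊤))
    (V : ι → Scheme.{0}) [∀ R, IsLocallyNoetherian (V R)] (fV : ∀ R, V R ⟶ Spec (.of ℚ))
    (ZV : ∀ R, PolarizedAbelianSchemeWithLevel g N δ (V R)) (huniv : ∀ R, Fr (ZV R) R)
    (hrep : ∀ R ⦃T : Scheme.{0}⦄ [IsLocallyNoetherian T] (_fT : T ⟶ Spec (.of ℚ))
      (P' : PolarizedAbelianSchemeWithLevel g N δ T), Fr P' R →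
      ∃! v : T ⟶ V R, ∃ (G : P'.A.X.left ⟶ (ZV R).A.X.left) (Ĝ : P'.D.hat.X.left ⟶ (ZV R).D.hat.X.left),
        P'.IsBaseChangeVia (ZV R) v G Ĝ)
    (hprojV : ∀ R, IsProjective (ZV R).A.X.hom)
    (hdual : ∀ ⦃S : Scheme.{0}⦄ [IsLocallyNoetherian S] (_fS : S ⟶ Spec (.of ℚ)) (A : AbelianSchemeOver S),
      (∀ s : S, ∃ (U : Scheme.{0}) (i : U ⟶ S) (_ : IsOpenImmersion i) (_ : s ∈ Set.range i.base)
        (B : AbelianSchemeOver U) (G : B.X.left ⟶ A.X.left), B.IsBaseChangeVia A i G ∧ IsProjective B.X.hom) →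
      Nonempty A.DualPair)
    (unitV : ∀ R, Nonempty ((Scheme.Modules.pullback (DualPair.unitHatSlice (ZV R).D)).obj (ZV R).D.P ≅
      SheafOfModules.unit _))
    (hcov : ∀ ⦃Ω : Type⦄ [Field Ω] [IsAlgClosed Ω] (_ : Spec (.of Ω) ⟶ Spec (.of ℚ))
      (Q : PolarizedAbelianSchemeWithLevel g N δ (Spec (.of Ω))), ∃ R, Fr Q R) :
    Nonempty (SiegelFineModuliScheme g N δ) := by
  obtain ⟨𝓜, -⟩ :=
    exists_siegelFineModuliScheme_of_representedCharts hN hδ Fr frOpen hFr V fV ZV huniv hrep hprojV hdual unitV hcov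
  exact ⟨𝓜⟩

end Literature.AlgebraicGeometry.ModuliOfAbelianVarieties

end
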